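import Summits.BirchSwinnertonDyer.BirchSwinnertonDyer.Theorems.ThetaPartnerAtTwoMazurTateCongruenceAtTwoRFourFacts
import Summits.BirchSwinnertonDyer.BirchSwinnertonDyer.Theorems.ThetaPartnerAtTwoMazurTateCongruenceAtTwoRLayerToLambda
import Summits.BirchSwinnertonDyer.BirchSwinnertonDyer.Theorems.ThetaPartnerAtTwoMazurTateCongruenceAtTwoROfLambda
import Summits.BirchSwinnertonDyer.BirchSwinnertonDyer.Theorems.ThetaPartnerAtTwoMazurTateCongruenceAtTwoREulerCongruence
import Summits.BirchSwinnertonDyer.BirchSwinnertonDyer.Theorems.ThetaPartnerAtTwoSignedTransportAtTwoBridge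
import HarnessLib

/-!
# Crux `MazurTateCongruenceAtTwoTop` (stmt-BirchSwinnertonDyer-25797 = `MazurTateCongruenceAtTwoR` 21416), line `symbol`:
# the EXACT research residue — «`μ`-INVARIANCE AT `2` ON THE THETA HABITAT» (Greenberg–Vatsal Thm. (1.4) at `p = 2`)
# (lead prover bsd-wall-tp2-p1 g11; `--supports stmt-BirchSwinnertonDyer-25797`; closes nothing)

HONEST FRAMING. THEOREMS ONLY (no `def`, no new named fact, no `sorry`). The named Literature facts and the `μ`-invariance statement
are explicit HYPOTHESES; nothing about their truth is asserted; BSD is not proved by any of this.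

WHY. Line `symbol` has the crux BY NAME from PUB⁴ (Eichler–Shimura for the depleted optimal quotient, Hecke self-duality, Buzzard,
Serre 1972) + the period fact at `2` + ONE research input, so far taken as «`μ = 0`» for BOTH curves of every theta pair (in three
currencies: `CuspSpanEvenAtTwo` at odd levels, (PR₂), FLAT — `…RFourFacts`, `…RFourFactsPointwise`, `…RSymbolMuOfFlat`). That input is
STRONGER than the crux needs: the crux is a CONGRUENCE between `W` and its CM partner `A`, and when `μ > 0` on both sides the congruence
`L♭_W·E_{S₀}(W) ≡ L♭_A·E_{S₀}(A) (mod 2Λ)` holds trivially. This file proves that the exact residue is the `p = 2` analogue of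
Greenberg–Vatsal's `μ`-INVARIANCE under `W[2] ≃ A[2]` (Invent. Math. 142 (2000), Thm. (1.4): for `p` odd ordinary and `E₁[p] ≅ E₂[p]`
irreducible, `μ(E₁) = 0 ⟺ μ(E₂) = 0`), in FLAT currency:

  (μ-INV₂)  for every theta pair `(W, A)` as in the crux, newforms `f, f_A` and Pollack pairs at `2`:
            `L♭_W = kobayashiL 1 L⁺ L⁻` has a unit coefficient ⟺ `L♭_A = kobayashiL 1 L⁺_A L⁻_A` has a unit coefficient.
* §1 algebra in `Λ = ℤ₂⟦T⟧`: no unit coefficient ⟺ `2 ∣ L`; `2 ∣ L·E`, `E ≢ 0 (mod 2)` ⟹ `2 ∣ L`; a flat congruence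
  `L·E − u·L_A·E_A ∈ 2Λ` with `E, E_A ≢ 0 (mod 2)` transports «has a unit coefficient» both ways (`exists_isUnit_coeff_iff_of_flatCongruence`).
* §2 `mazurTateCongruence_of_forall_not_isUnit_coeff` — the TRIVIAL BRANCH: if neither `L♭_W` nor `L♭_A` has a unit coefficient, the
  conclusion of the crux holds at that datum (PUB-free except `‖ϖ‖₂ = ‖ϖ_A‖₂ = 1`; w2 g0's `lambda_congruence_two_of_flat_congruence` +
  `layer_congruence_two_of_lambda_congruence`).
* §3 `mazurTateCongruence_of_fourFacts_flatIff` — the conclusion of the crux at one pair from PUB⁴ + the period fact + (FLAT_W ↔ FLAT_A)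
  (case split; the both-flat case as in w2 g2's `mazurTateCongruence_of_fourFacts_flat`).
* §4 `mazurTateCongruenceAtTwoTop_of_fourFacts_muInvariance` — THE CRUX BY NAME from PUB⁴ + the period fact + (μ-INV₂); five-fact form
  with Abbes–Ullmo; twin 21416.
* §5 `flatIff_of_mazurTateCongruenceAtTwoTop` — CONVERSELY the crux implies (μ-INV₂) granted only the period fact (w2 g0's
  layers → `Λ` → flat transfer `lambda_congruence_two_of_layer_congruences` / `flat_congruence_two_of_lambda_congruence` tested on the
  unit multiples `G = ϖ̃·L♭`, then §1; the cyclotomic variable and the admissible `S₀` the crux wants are inhabited: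
  `exists_isCyclotomic_isTopGenerator_isCyclotomicVariable_holds`, `SignedTransportAtTwo.exists_admissiblePlaces`), and
  `mazurTateCongruenceAtTwoTop_iff_muInvariance` — **modulo PUB⁴ + the period fact, the crux ⟺ (μ-INV₂)**.

So the K1 row's research residue is not «`μ = 0` at `2`» (Pollack 2003 Conj. 6.3 / the (G′)_N node, each of which IMPLIES (μ-INV₂)) but
the weaker and EXACT «`μ`-invariance at `2` under the residual isomorphism» (odd-`p` supersingular analogue: B. D. Kim 2009 + Greenberg–Vatsal
§3; unprinted at `p = 2`). Nothing is asserted about it. BSD is not proved by any of this.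
References: [GreenbergVatsal2000] Thm. (1.4), §3 (13), Rem. 3.4; [Vatsal1999] (1.10), (1.13); [BDKim2009] Thm. 1.1; [Pollack2003]
Conj. 6.3, Prop. 6.18; [Buzzard2000LevelLoweringModTwo] Prop. 2.4; [AbbesUllmo1996] Thm. A; [Washington1997] §7.1.
-/

-- justification: the `Summit.BirchSwinnertonDyer.BirchSwinnertonDyer.…` path repeats a component (route-file convention)
set_option linter.dupNamespace false
set_option autoImplicit false

noncomputable section

open scoped Classical MatrixGroups ModularForm

open CongruenceSubgroup Polynomial WeierstrassCurve NumberField IsDedekindDomain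
  Literature.NumberTheory.IwasawaTheory Literature.NumberTheory.EllipticCurves Literature.NumberTheory.EllipticCurves.ModularForms
  Literature.NumberTheory.EllipticCurves.Rank1Residual Literature.NumberTheory.EllipticCurves.GreenbergVatsal2000
  Literature.NumberTheory.EllipticCurves.Sprung2017
  Summit.BirchSwinnertonDyer.Rank1Residual.Supersingular
  Summit.BirchSwinnertonDyer.BirchSwinnertonDyer.Theorems.ThetaLayerLambdaCongruenceAtTwo

namespace Summit.BirchSwinnertonDyer.BirchSwinnertonDyer.Theorems.MazurTateCongruenceAtTwoR

/-! ## §1. Algebra in `Λ = ℤ₂⟦T⟧`: «has a unit coefficient» and divisibility by `2` -/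

section Algebra

/-- A power series over `ℤ₂` with no unit coefficient is divisible by `2` (its reduction mod `2` vanishes). [cite: Washington1997, §7.1] -/
theorem C_two_dvd_of_forall_not_isUnit_coeff {L : IwasawaAlgebra 2} (h : ∀ n : ℕ, ¬ IsUnit (PowerSeries.coeff n L)) :
    PowerSeries.C (2 : ℤ_[2]) ∣ L := by
  rw [C_two_dvd_iff_map_toZMod_eq_zero]
  ext n
  rw [PowerSeries.coeff_map, map_zero]
  have hmem : PowerSeries.coeff n L ∈ RingHom.ker (PadicInt.toZMod (p := 2)) := by
    rw [PadicInt.ker_toZMod, IsLocalRing.mem_maximalIdeal]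
    exact h n
  exact hmem

/-- **FLAT ⟺ `2 ∤ L`**: a power series over `ℤ₂` has a unit coefficient iff `2 ∤ L` (`μ(L) = 0`). [cite: Washington1997, §7.1] -/
theorem exists_isUnit_coeff_iff_not_C_two_dvd (L : IwasawaAlgebra 2) :
    (∃ n : ℕ, IsUnit (PowerSeries.coeff n L)) ↔ ¬ PowerSeries.C (2 : ℤ_[2]) ∣ L := by
  refine ⟨not_C_two_dvd_of_exists_isUnit_coeff, fun h ↦ ?_⟩
  by_contra hne
  push Not at hne
  exact h (C_two_dvd_of_forall_not_isUnit_coeff hne)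

/-- If `2 ∣ L·E` in `ℤ₂⟦T⟧` and `E ≢ 0 (mod 2)`, then `2 ∣ L` (`𝔽₂⟦T⟧` is a domain). [cite: Washington1997, §7.1] -/
theorem C_two_dvd_of_C_two_dvd_mul {L E : IwasawaAlgebra 2}
    (hE : PowerSeries.map (PadicInt.toZMod (p := 2)) E ≠ 0) (h : PowerSeries.C (2 : ℤ_[2]) ∣ L * E) :
    PowerSeries.C (2 : ℤ_[2]) ∣ L := by
  rw [C_two_dvd_iff_map_toZMod_eq_zero] at h ⊢
  rw [map_mul] at h
  exact (mul_eq_zero.mp h).resolve_right hE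

/-- **A flat congruence transports «has a unit coefficient» both ways.** If `L·E − u·L_A·E_A ∈ 2Λ` with `u ∈ ℤ₂ˣ` and
`E, E_A ≢ 0 (mod 2)`, then `L` has a unit coefficient iff `L_A` does (`μ(L) = 0 ⟺ μ(L_A) = 0`). [cite: GreenbergVatsal2000, §3, (13)]
[cite: Washington1997, §7.1] -/
theorem exists_isUnit_coeff_iff_of_flatCongruence {L LA E EA : IwasawaAlgebra 2}
    (hE : PowerSeries.map (PadicInt.toZMod (p := 2)) E ≠ 0) (hEA : PowerSeries.map (PadicInt.toZMod (p := 2)) EA ≠ 0)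
    {u : ℤ_[2]ˣ} {q : IwasawaAlgebra 2} (h : L * E - PowerSeries.C (u : ℤ_[2]) * LA * EA = PowerSeries.C (2 : ℤ_[2]) * q) :
    (∃ n : ℕ, IsUnit (PowerSeries.coeff n L)) ↔ (∃ n : ℕ, IsUnit (PowerSeries.coeff n LA)) := by
  rw [exists_isUnit_coeff_iff_not_C_two_dvd, exists_isUnit_coeff_iff_not_C_two_dvd, not_iff_not]
  have hu : IsUnit (PowerSeries.C (u : ℤ_[2]) : IwasawaAlgebra 2) := u.isUnit.map PowerSeries.C
  constructor
  · rintro ⟨M, hM⟩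
    have h1 : PowerSeries.C (2 : ℤ_[2]) ∣ PowerSeries.C (u : ℤ_[2]) * (LA * EA) :=
      ⟨M * E - q, by linear_combination -h + E * hM⟩
    exact C_two_dvd_of_C_two_dvd_mul hEA (hu.dvd_mul_left.mp h1)
  · rintro ⟨MA, hMA⟩
    have h1 : PowerSeries.C (2 : ℤ_[2]) ∣ L * E :=
      ⟨q + PowerSeries.C (u : ℤ_[2]) * MA * EA, by linear_combination h + (PowerSeries.C (u : ℤ_[2]) * EA) * hMA⟩
    exact C_two_dvd_of_C_two_dvd_mul hE h1

end Algebra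

/-! ## §2. The trivial branch: `μ > 0` on both sides ⟹ the congruence at every even layer -/

section Trivial

/-- **Both `μ > 0` ⟹ the conclusion of the crux at that datum.** For weight-`2` cusp forms `f, f_A` with Pollack pairs at `2`, rationals
`ϖ, ϖ_A` of `2`-adic norm `1`, integral multiples `ι G = 2^m ϖ ι L♭`, `ι G_A = 2^{m'} ϖ_A ι L♭_A` and ANY depleting factors
`E, E_A ∈ Λ`: if neither `L♭ = kobayashiL 1 L⁺ L⁻` nor `L♭_A` has a unit coefficient (both `μ ≥ 1`), then for `u = 1`-shaped data the
oriented Mazur–Tate congruence holds at every even layer — `L♭·E − L♭_A·E_A ∈ 2Λ` trivially, then w2 g0's Λ → layers transfer.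
No Literature fact is used. [cite: GreenbergVatsal2000, §3, (13)] [cite: Pollack2003, Prop. 6.18] -/
theorem mazurTateCongruence_of_forall_not_isUnit_coeff {N NA : ℕ} (f : CuspForm (Gamma0 N) 2) (fA : CuspForm (Gamma0 NA) 2)
    {Lplus Lminus LplusA LminusA : IwasawaAlgebra 2}
    (hPP : IsPollackPair f 2 Lplus Lminus) (hPPA : IsPollackPair fA 2 LplusA LminusA)
    {ϖ ϖA : ℚ} (hϖ1 : ‖(ϖ : ℚ_[2])‖ = 1) (hϖA1 : ‖(ϖA : ℚ_[2])‖ = 1)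
    (hW : ∀ n : ℕ, ¬ IsUnit (PowerSeries.coeff n (kobayashiL 1 Lplus Lminus)))
    (hA : ∀ n : ℕ, ¬ IsUnit (PowerSeries.coeff n (kobayashiL 1 LplusA LminusA)))
    (E EA : IwasawaAlgebra 2) {G GA : IwasawaAlgebra 2} {m m' : ℕ}
    (hG : iwasawaToPowerSeries 2 G =
      PowerSeries.C ((2 : ℚ_[2]) ^ m * (ϖ : ℚ_[2])) * iwasawaToPowerSeries 2 (kobayashiL 1 Lplus Lminus))
    (hGA : iwasawaToPowerSeries 2 GA =
      PowerSeries.C ((2 : ℚ_[2]) ^ m' * (ϖA : ℚ_[2])) * iwasawaToPowerSeries 2 (kobayashiL 1 LplusA LminusA)) :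
    ∃ u : ℤ_[2]ˣ, ∀ n : ℕ, Even n → ∃ q r : IwasawaAlgebra 2,
      PowerSeries.C (((2 : ℤ_[2]) ^ m' : ℤ_[2]) : ℚ_[2]) *
            (PowerSeries.C ((2 : ℚ_[2]) ^ m * (ϖ : ℚ_[2])) *
              ((mazurTateElement f 2 n).map (algebraMap ℚ ℚ_[2]) : PowerSeries ℚ_[2]) *
              iwasawaToPowerSeries 2 E) -
          PowerSeries.C (((u : ℤ_[2]) * (2 : ℤ_[2]) ^ m : ℤ_[2]) : ℚ_[2]) *
            (PowerSeries.C ((2 : ℚ_[2]) ^ m' * (ϖA : ℚ_[2])) *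
              ((mazurTateElement fA 2 n).map (algebraMap ℚ ℚ_[2]) : PowerSeries ℚ_[2]) *
              iwasawaToPowerSeries 2 EA) =
        iwasawaToPowerSeries 2 (PowerSeries.C ((2 : ℤ_[2]) ^ (m + m' + 1)) * q + toIwasawa 2 (cyclotomicOmega 2 n) * r) := by
  obtain ⟨P, hP⟩ := C_two_dvd_of_forall_not_isUnit_coeff hW
  obtain ⟨PA, hPA⟩ := C_two_dvd_of_forall_not_isUnit_coeff hA
  have hflat : kobayashiL 1 Lplus Lminus * E - PowerSeries.C ((1 : ℤ_[2]ˣ) : ℤ_[2]) * kobayashiL 1 LplusA LminusA * EA =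
      PowerSeries.C (2 : ℤ_[2]) * (P * E - PA * EA) := by
    rw [hP, hPA, Units.val_one, map_one, one_mul]
    ring
  obtain ⟨u, q₀, hΛ⟩ := lambda_congruence_two_of_flat_congruence hϖ1 hϖA1 hG hGA hflat
  exact ⟨u, fun n hn ↦ layer_congruence_two_of_lambda_congruence f fA hPP hPPA hG hGA hΛ hn⟩

end Trivial

/-! ## §3. The conclusion of the crux at one pair from PUB⁴ + the period fact + `μ`-invariance at that pair -/

section Pair

variable (W : WeierstrassCurve ℚ) [W.IsElliptic] [W.IsGloballyMinimal] (A : WeierstrassCurve ℚ) [A.IsElliptic]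
  [A.IsGloballyMinimal]

/-- **`μ`-invariance ⟹ the congruence, at one pair.** For `W, A` globally minimal, good supersingular at `2` with `a₂ = 0`, `Δ_W < 0`,
a Galois-equivariant `W[2] ≃+ A[2]`, newforms `f, f_A`, Néron ratios `ϖ, ϖ_A`, Pollack pairs at `2`, an admissible `S₀` and integral
multiples `G, G_A`: granted the four named facts of the plus line and the period fact, IF «`L♭_W` has a unit coefficient ⟺ `L♭_A` has a
unit coefficient» THEN the oriented `S₀`-depleted Mazur–Tate congruence holds at every even layer. Case split: both flat ⟹ the four-fact
plus line + `symbolMu_of_flat` twice (as in w2 g2's `mazurTateCongruence_of_fourFacts_flat`, `u = 1`); neither flat ⟹ §2. [cite: GreenbergVatsal2000, Thm. (1.4), §3 (13)]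
[cite: Buzzard2000LevelLoweringModTwo, Prop. 2.4] [cite: Pollack2003, Prop. 6.18] -/
theorem mazurTateCongruence_of_fourFacts_flatIff
    (hES : eichlerShimura_depletedOptimalQuotient_periodLattice_of_dvd) (hSD : heckeSelfDual_torsionBy_J0)
    (hBz : buzzard2000_multiplicityOne_gamma0) (hSe : serre1972_supersingular_decompositionSubgroup_image)
    (h2 : realPeriodRat_eq_unit_mul_plusPeriod_two)
    (hss : GoodSS W 2) (ha : W.frobeniusTrace 2 = 0) (hΔ : W.Δ < 0) (hssA : GoodSS A 2) (haA : A.frobeniusTrace 2 = 0)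
    (he : ∃ e : geomTorsion W (2 : ℤ) ≃+ geomTorsion A (2 : ℤ),
      ∀ (σ : Field.absoluteGaloisGroup ℚ) (P : geomTorsion W (2 : ℤ)), e (σ • P) = σ • e P)
    [NeZero (W.conductorNorm ℤ)] (f : CuspForm (Gamma0 (W.conductorNorm ℤ)) 2) (hf : IsNewformOf W f) {ϖ : ℚ}
    (hϖ : (ϖ : ℝ) * W.realPeriodRat = plusPeriod f)
    {Lplus Lminus : IwasawaAlgebra 2} (hPP : IsPollackPair f 2 Lplus Lminus)
    [NeZero (A.conductorNorm ℤ)] (fA : CuspForm (Gamma0 (A.conductorNorm ℤ)) 2) (hfA : IsNewformOf A fA) {ϖA : ℚ}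
    (hϖA : (ϖA : ℝ) * A.realPeriodRat = plusPeriod fA)
    {LplusA LminusA : IwasawaAlgebra 2} (hPPA : IsPollackPair fA 2 LplusA LminusA)
    (hIff : (∃ n : ℕ, IsUnit (PowerSeries.coeff n (kobayashiL 1 Lplus Lminus))) ↔
      (∃ n : ℕ, IsUnit (PowerSeries.coeff n (kobayashiL 1 LplusA LminusA))))
    (S₀ : Finset (HeightOneSpectrum (𝓞 ℚ))) (hS2 : ∀ v ∈ S₀, ((2 : ℕ) : 𝓞 ℚ) ∉ v.asIdeal)
    (hSW : ∀ v : HeightOneSpectrum (𝓞 ℚ), ¬ W.HasGoodReductionAt v → v ∈ S₀)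
    (hSA : ∀ v : HeightOneSpectrum (𝓞 ℚ), ¬ A.HasGoodReductionAt v → v ∈ S₀)
    {G GA : IwasawaAlgebra 2} {m m' : ℕ}
    (hG : iwasawaToPowerSeries 2 G =
      PowerSeries.C ((2 : ℚ_[2]) ^ m * (ϖ : ℚ_[2])) * iwasawaToPowerSeries 2 (kobayashiL 1 Lplus Lminus))
    (hGA : iwasawaToPowerSeries 2 GA =
      PowerSeries.C ((2 : ℚ_[2]) ^ m' * (ϖA : ℚ_[2])) * iwasawaToPowerSeries 2 (kobayashiL 1 LplusA LminusA)) :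
    ∃ u : ℤ_[2]ˣ, ∀ n : ℕ, Even n → ∃ q r : IwasawaAlgebra 2,
      PowerSeries.C (((2 : ℤ_[2]) ^ m' : ℤ_[2]) : ℚ_[2]) *
            (PowerSeries.C ((2 : ℚ_[2]) ^ m * (ϖ : ℚ_[2])) *
              ((mazurTateElement f 2 n).map (algebraMap ℚ ℚ_[2]) : PowerSeries ℚ_[2]) *
              iwasawaToPowerSeries 2 (eulerFactorProductInv W 2 S₀)) -
          PowerSeries.C (((u : ℤ_[2]) * (2 : ℤ_[2]) ^ m : ℤ_[2]) : ℚ_[2]) *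
            (PowerSeries.C ((2 : ℚ_[2]) ^ m' * (ϖA : ℚ_[2])) *
              ((mazurTateElement fA 2 n).map (algebraMap ℚ ℚ_[2]) : PowerSeries ℚ_[2]) *
              iwasawaToPowerSeries 2 (eulerFactorProductInv A 2 S₀)) =
        iwasawaToPowerSeries 2 (PowerSeries.C ((2 : ℤ_[2]) ^ (m + m' + 1)) * q + Sprung2017.toIwasawa 2 (cyclotomicOmega 2 n) * r) := by
  by_cases hW : ∃ n : ℕ, IsUnit (PowerSeries.coeff n (kobayashiL 1 Lplus Lminus))
  · exact mazurTateCongruence_of_plusLine W A (plusLineAtTwoLevel_of_charTwoLevel (plusLineCharTwo_of_fourFacts hES hSD hBz hSe))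
      hss hΔ hssA he f hf ϖ hPP fA hfA ϖA hPPA S₀ hS2 hSW hSA (symbolMu_of_flat W h2 hss ha hf hϖ hPP hW S₀ hS2)
      (symbolMu_of_flat A h2 hssA haA hfA hϖA hPPA (hIff.mp hW) S₀ hS2) hG hGA
  · have hA : ¬ ∃ n : ℕ, IsUnit (PowerSeries.coeff n (kobayashiL 1 LplusA LminusA)) := fun h ↦ hW (hIff.mpr h)
    push Not at hW hA
    exact mazurTateCongruence_of_forall_not_isUnit_coeff f fA hPP hPPA (norm_ratCast_periodRatio_eq_one_two h2 W hss hf hϖ)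
      (norm_ratCast_periodRatio_eq_one_two h2 A hssA hfA hϖA) hW hA _ _ hG hGA

end Pair

/-! ## §4. THE CRUX BY NAME from PUB⁴ + the period fact + `μ`-invariance at `2` on the theta habitat -/

section Crux

/-- **`MazurTateCongruenceAtTwoTop` (crux 25797 = 21416) BY NAME from PUB⁴ + the period fact + (μ-INV₂).** Granted the four named facts
of the plus line (Eichler–Shimura for the depleted optimal quotient, Hecke self-duality of `J₀[ℓ]`, Buzzard's mod-`2` multiplicity one,
Serre 1972 Prop. 12), the period fact `realPeriodRat_eq_unit_mul_plusPeriod_two`, and «`μ`-INVARIANCE AT `2` ON THE THETA HABITAT»: for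
every theta pair `(W, A)` exactly as the crux binds it (`W` non-CM of analytic rank `0`, both good supersingular at `2` with `a₂ = 0`, `A` CM,
`W[2] ≃ A[2]` equivariantly), newforms `f, f_A` and Pollack pairs at `2`, `L♭_W` has a unit coefficient iff `L♭_A` does — the crux holds.
`HΔ` by the tree's `ThetaPartnerXRoute.Δ_neg_of_cmPartner_two`; the pair by §3. (μ-INV₂) is the `p = 2` supersingular analogue of
Greenberg–Vatsal Thm. (1.4) (research; unprinted at `p = 2`); nothing is asserted about it. BSD is not proved by this.
[cite: GreenbergVatsal2000, Thm. (1.4), §3 (13)] [cite: BDKim2009, Thm. 1.1] [cite: Buzzard2000LevelLoweringModTwo, Prop. 2.4] -/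
theorem mazurTateCongruenceAtTwoTop_of_fourFacts_muInvariance
    (hES : eichlerShimura_depletedOptimalQuotient_periodLattice_of_dvd) (hSD : heckeSelfDual_torsionBy_J0)
    (hBz : buzzard2000_multiplicityOne_gamma0) (hSe : serre1972_supersingular_decompositionSubgroup_image)
    (h2 : realPeriodRat_eq_unit_mul_plusPeriod_two)
    (hInv : ∀ (W : WeierstrassCurve ℚ) [W.IsElliptic] [W.IsGloballyMinimal] (A : WeierstrassCurve ℚ) [A.IsElliptic]
      [A.IsGloballyMinimal], ¬ W.HasCM → W.analyticRank = 0 → GoodSS W 2 → W.frobeniusTrace 2 = 0 → A.HasCM → GoodSS A 2 →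
      A.frobeniusTrace 2 = 0 →
      (∃ e : geomTorsion W (2 : ℤ) ≃+ geomTorsion A (2 : ℤ),
        ∀ (σ : Field.absoluteGaloisGroup ℚ) (P : geomTorsion W (2 : ℤ)), e (σ • P) = σ • e P) →
      ∀ [NeZero (W.conductorNorm ℤ)] (f : CuspForm (Gamma0 (W.conductorNorm ℤ)) 2), IsNewformOf W f →
      ∀ (Lplus Lminus : IwasawaAlgebra 2), IsPollackPair f 2 Lplus Lminus →
      ∀ [NeZero (A.conductorNorm ℤ)] (fA : CuspForm (Gamma0 (A.conductorNorm ℤ)) 2), IsNewformOf A fA →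
      ∀ (LplusA LminusA : IwasawaAlgebra 2), IsPollackPair fA 2 LplusA LminusA →
      ((∃ n : ℕ, IsUnit (PowerSeries.coeff n (kobayashiL 1 Lplus Lminus))) ↔
        (∃ n : ℕ, IsUnit (PowerSeries.coeff n (kobayashiL 1 LplusA LminusA))))) :
    Summit.BirchSwinnertonDyer.BirchSwinnertonDyer.Theses.ThetaPartnerAtTwo.MazurTateCongruenceAtTwoTop := by
  intro W _ _ A _ _ hcm hr hss ha hAcm hAss hAa he γ _ _ f hf ϖ hϖ Lplus Lminus hPP _ fA hfA ϖA hϖA LplusA LminusA hPPA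
    S₀ hS2 hSW hSA G m hG GA m' hGA
  have hΔ : W.Δ < 0 := by
    obtain ⟨e, he'⟩ := he
    exact ThetaPartnerXRoute.Δ_neg_of_cmPartner_two W A hAcm hAss e he'
  exact mazurTateCongruence_of_fourFacts_flatIff W A hES hSD hBz hSe h2 hss ha hΔ hAss hAa he f hf hϖ hPP fA hfA hϖA hPPA
    (hInv W A hcm hr hss ha hAcm hAss hAa he f hf Lplus Lminus hPP fA hfA LplusA LminusA hPPA) S₀ hS2 hSW hSA hG hGA

/-- **PUB⁵ form**: the crux BY NAME from the five named facts Eichler–Shimura (depleted optimal quotient), Hecke self-duality, Buzzard,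
Serre 1972, Abbes–Ullmo Thm. A, and (μ-INV₂) (the period fact DERIVED from Abbes–Ullmo by
`SkinnerUrban2014.realPeriodRat_eq_unit_mul_plusPeriod_two_fact_of_abbesUllmo`). BSD is not proved by this. [cite: AbbesUllmo1996, Thm. A]
[cite: GreenbergVatsal2000, Thm. (1.4), §3 (13)] -/
theorem mazurTateCongruenceAtTwoTop_of_fiveFacts_muInvariance
    (hES : eichlerShimura_depletedOptimalQuotient_periodLattice_of_dvd) (hSD : heckeSelfDual_torsionBy_J0)
    (hBz : buzzard2000_multiplicityOne_gamma0) (hSe : serre1972_supersingular_decompositionSubgroup_image)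
    (hAU : abbesUllmo_not_dvd_maninConstant_of_not_dvd_level)
    (hInv : ∀ (W : WeierstrassCurve ℚ) [W.IsElliptic] [W.IsGloballyMinimal] (A : WeierstrassCurve ℚ) [A.IsElliptic]
      [A.IsGloballyMinimal], ¬ W.HasCM → W.analyticRank = 0 → GoodSS W 2 → W.frobeniusTrace 2 = 0 → A.HasCM → GoodSS A 2 →
      A.frobeniusTrace 2 = 0 →
      (∃ e : geomTorsion W (2 : ℤ) ≃+ geomTorsion A (2 : ℤ),
        ∀ (σ : Field.absoluteGaloisGroup ℚ) (P : geomTorsion W (2 : ℤ)), e (σ • P) = σ • e P) →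
      ∀ [NeZero (W.conductorNorm ℤ)] (f : CuspForm (Gamma0 (W.conductorNorm ℤ)) 2), IsNewformOf W f →
      ∀ (Lplus Lminus : IwasawaAlgebra 2), IsPollackPair f 2 Lplus Lminus →
      ∀ [NeZero (A.conductorNorm ℤ)] (fA : CuspForm (Gamma0 (A.conductorNorm ℤ)) 2), IsNewformOf A fA →
      ∀ (LplusA LminusA : IwasawaAlgebra 2), IsPollackPair fA 2 LplusA LminusA →
      ((∃ n : ℕ, IsUnit (PowerSeries.coeff n (kobayashiL 1 Lplus Lminus))) ↔
        (∃ n : ℕ, IsUnit (PowerSeries.coeff n (kobayashiL 1 LplusA LminusA))))) :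
    Summit.BirchSwinnertonDyer.BirchSwinnertonDyer.Theses.ThetaPartnerAtTwo.MazurTateCongruenceAtTwoTop :=
  mazurTateCongruenceAtTwoTop_of_fourFacts_muInvariance hES hSD hBz hSe
    (SkinnerUrban2014.realPeriodRat_eq_unit_mul_plusPeriod_two_fact_of_abbesUllmo hAU) hInv

/-- The twin `MazurTateCongruenceAtTwoR` (stmt-21416) BY NAME from PUB⁴ + the period fact + (μ-INV₂) (definitionally the same statement).
BSD is not proved by this. [cite: GreenbergVatsal2000, Thm. (1.4), §3 (13)] -/
theorem mazurTateCongruenceAtTwoR_of_fourFacts_muInvariance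
    (hES : eichlerShimura_depletedOptimalQuotient_periodLattice_of_dvd) (hSD : heckeSelfDual_torsionBy_J0)
    (hBz : buzzard2000_multiplicityOne_gamma0) (hSe : serre1972_supersingular_decompositionSubgroup_image)
    (h2 : realPeriodRat_eq_unit_mul_plusPeriod_two)
    (hInv : ∀ (W : WeierstrassCurve ℚ) [W.IsElliptic] [W.IsGloballyMinimal] (A : WeierstrassCurve ℚ) [A.IsElliptic]
      [A.IsGloballyMinimal], ¬ W.HasCM → W.analyticRank = 0 → GoodSS W 2 → W.frobeniusTrace 2 = 0 → A.HasCM → GoodSS A 2 →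
      A.frobeniusTrace 2 = 0 →
      (∃ e : geomTorsion W (2 : ℤ) ≃+ geomTorsion A (2 : ℤ),
        ∀ (σ : Field.absoluteGaloisGroup ℚ) (P : geomTorsion W (2 : ℤ)), e (σ • P) = σ • e P) →
      ∀ [NeZero (W.conductorNorm ℤ)] (f : CuspForm (Gamma0 (W.conductorNorm ℤ)) 2), IsNewformOf W f →
      ∀ (Lplus Lminus : IwasawaAlgebra 2), IsPollackPair f 2 Lplus Lminus →
      ∀ [NeZero (A.conductorNorm ℤ)] (fA : CuspForm (Gamma0 (A.conductorNorm ℤ)) 2), IsNewformOf A fA →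
      ∀ (LplusA LminusA : IwasawaAlgebra 2), IsPollackPair fA 2 LplusA LminusA →
      ((∃ n : ℕ, IsUnit (PowerSeries.coeff n (kobayashiL 1 Lplus Lminus))) ↔
        (∃ n : ℕ, IsUnit (PowerSeries.coeff n (kobayashiL 1 LplusA LminusA))))) :
    Summit.BirchSwinnertonDyer.BirchSwinnertonDyer.Theses.ThetaPartnerAtTwo.MazurTateCongruenceAtTwoR :=
  mazurTateCongruenceAtTwoTop_of_fourFacts_muInvariance hES hSD hBz hSe h2 hInv

end Crux

/-! ## §5. Conversely: the crux implies `μ`-invariance (granted the period fact); the EXACT residue -/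

section Converse

/-- `|u⁻¹|₂ = 1` and `u⁻¹ · (u · Ω⁺) = Ω⁺` for a rational `u` with `|u|₂ = 1` (private copy of w2 g0's
`norm_inv_eq_one_and_inv_mul_eq`, `…RNormalForm`). [cite: GreenbergVatsal2000, §3, Remark (3.4)] -/
private theorem norm_inv_eq_one_and_inv_mul_eq_aux {u : ℚ} (hu : ‖(u : ℚ_[2])‖ = 1) {Ω P : ℝ} (hΩ : Ω = u * P) :
    ‖((u⁻¹ : ℚ) : ℚ_[2])‖ = 1 ∧ ((u⁻¹ : ℚ) : ℝ) * Ω = P := by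
  have hu0 : u ≠ 0 := by
    rintro rfl
    rw [Rat.cast_zero, norm_zero] at hu
    exact zero_ne_one hu
  refine ⟨by rw [Rat.cast_inv, norm_inv, hu, inv_one], ?_⟩
  rw [hΩ, ← mul_assoc, Rat.cast_inv, inv_mul_cancel₀ (by exact_mod_cast hu0), one_mul]

/-- **The crux ⟹ (μ-INV₂), granted the period fact.** If `MazurTateCongruenceAtTwoTop` holds then, for every theta pair `(W, A)` as the
crux binds it, newforms and Pollack pairs at `2`: `L♭_W` has a unit coefficient iff `L♭_A` does. Proof: a cyclotomic variable and an
admissible `S₀` (odd places containing the bad places of both curves) exist; the period fact gives Néron ratios `ϖ = u_W⁻¹`, `ϖ_A = u_A⁻¹`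
of norm `1`; the crux, tested on every integral multiple, gives the `Λ`-congruence (`lambda_congruence_two_of_layer_congruences`) and then
the flat congruence `L♭_W·E_{S₀}(W) − u·L♭_A·E_{S₀}(A) ∈ 2Λ` (`flat_congruence_two_of_lambda_congruence`); the depleting factors have
`μ = 0` (`map_toZMod_eulerFactorProductInv_two_ne_zero`); §1 transports the unit coefficient.
[cite: GreenbergVatsal2000, Thm. (1.4), §3 (13) and Remark 3.4] [cite: AbbesUllmo1996, Thm. A] [cite: Pollack2003, Prop. 6.18] -/
theorem flatIff_of_mazurTateCongruenceAtTwoTop (h2 : realPeriodRat_eq_unit_mul_plusPeriod_two)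
    (hMT : Summit.BirchSwinnertonDyer.BirchSwinnertonDyer.Theses.ThetaPartnerAtTwo.MazurTateCongruenceAtTwoTop) :
    ∀ (W : WeierstrassCurve ℚ) [W.IsElliptic] [W.IsGloballyMinimal] (A : WeierstrassCurve ℚ) [A.IsElliptic]
      [A.IsGloballyMinimal], ¬ W.HasCM → W.analyticRank = 0 → GoodSS W 2 → W.frobeniusTrace 2 = 0 → A.HasCM → GoodSS A 2 →
      A.frobeniusTrace 2 = 0 →
      (∃ e : geomTorsion W (2 : ℤ) ≃+ geomTorsion A (2 : ℤ),
        ∀ (σ : Field.absoluteGaloisGroup ℚ) (P : geomTorsion W (2 : ℤ)), e (σ • P) = σ • e P) →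
      ∀ [NeZero (W.conductorNorm ℤ)] (f : CuspForm (Gamma0 (W.conductorNorm ℤ)) 2), IsNewformOf W f →
      ∀ (Lplus Lminus : IwasawaAlgebra 2), IsPollackPair f 2 Lplus Lminus →
      ∀ [NeZero (A.conductorNorm ℤ)] (fA : CuspForm (Gamma0 (A.conductorNorm ℤ)) 2), IsNewformOf A fA →
      ∀ (LplusA LminusA : IwasawaAlgebra 2), IsPollackPair fA 2 LplusA LminusA →
      ((∃ n : ℕ, IsUnit (PowerSeries.coeff n (kobayashiL 1 Lplus Lminus))) ↔
        (∃ n : ℕ, IsUnit (PowerSeries.coeff n (kobayashiL 1 LplusA LminusA)))) := by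
  intro W _ _ A _ _ hcm hr hss ha hAcm hAss hAa he _ f hf Lplus Lminus hPP _ fA hfA LplusA LminusA hPPA
  obtain ⟨κ, -, γ, -, hγ⟩ := exists_isCyclotomic_isTopGenerator_isCyclotomicVariable_holds 2
  obtain ⟨S₀, hS2, hSW, hSA⟩ := SignedTransportAtTwo.exists_admissiblePlaces W A hss.1 hAss.1
  -- Néron ratios from the period fact
  obtain ⟨uW, huW, hΩW⟩ := h2 W hss.1 (Summit.BirchSwinnertonDyer.Rank1Residual.P2.irr_two_of_goodSS_two W hss) f hf
  obtain ⟨uA, huA, hΩA⟩ := h2 A hAss.1 (Summit.BirchSwinnertonDyer.Rank1Residual.P2.irr_two_of_goodSS_two A hAss) fA hfA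
  obtain ⟨hϖ1, hϖ⟩ := norm_inv_eq_one_and_inv_mul_eq_aux huW hΩW
  obtain ⟨hϖA1, hϖA⟩ := norm_inv_eq_one_and_inv_mul_eq_aux huA hΩA
  -- the crux on every integral multiple ⟹ the `Λ`-congruence ⟹ the flat congruence
  obtain ⟨u, q, hq⟩ := flat_congruence_two_of_lambda_congruence (E := eulerFactorProductInv W 2 S₀)
    (EA := eulerFactorProductInv A 2 S₀) hϖ1 hϖA1 fun G m hG GA m' hGA ↦ by
    obtain ⟨u, hu⟩ := hMT W A hcm hr hss ha hAcm hAss hAa he γ hγ f hf uW⁻¹ hϖ Lplus Lminus hPP fA hfA uA⁻¹ hϖA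
      LplusA LminusA hPPA S₀ hS2 hSW hSA G m hG GA m' hGA
    exact ⟨u, lambda_congruence_two_of_layer_congruences f fA hPP hPPA hG hGA hu⟩
  exact exists_isUnit_coeff_iff_of_flatCongruence (map_toZMod_eulerFactorProductInv_two_ne_zero W S₀ hS2)
    (map_toZMod_eulerFactorProductInv_two_ne_zero A S₀ hS2) hq

/-- **THE EXACT RESIDUE OF THE K1 ROW.** Granted PUB⁴ (Eichler–Shimura for the depleted optimal quotient, Hecke self-duality, Buzzard's
mod-`2` multiplicity one, Serre 1972) and the period fact at `2`, the crux `MazurTateCongruenceAtTwoTop` (stmt-25797 = 21416) is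
EQUIVALENT to «`μ`-invariance at `2` on the theta habitat» (μ-INV₂): for every theta pair, newforms and Pollack pairs at `2`, `L♭_W` has a
unit coefficient iff `L♭_A` does — the `p = 2` supersingular analogue of Greenberg–Vatsal Thm. (1.4). Consequently every «`μ = 0` at `2`»
input used so far on this line ((G′)_N = `CuspSpanEvenAtTwo` at odd levels, (PR₂), FLAT, each for both curves) is SUFFICIENT but not
necessary. Nothing is asserted about (μ-INV₂). BSD is not proved by this. [cite: GreenbergVatsal2000, Thm. (1.4), §3 (13) and Remark 3.4]
[cite: BDKim2009, Thm. 1.1] [cite: Buzzard2000LevelLoweringModTwo, Prop. 2.4] [cite: AbbesUllmo1996, Thm. A] -/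
theorem mazurTateCongruenceAtTwoTop_iff_muInvariance
    (hES : eichlerShimura_depletedOptimalQuotient_periodLattice_of_dvd) (hSD : heckeSelfDual_torsionBy_J0)
    (hBz : buzzard2000_multiplicityOne_gamma0) (hSe : serre1972_supersingular_decompositionSubgroup_image)
    (h2 : realPeriodRat_eq_unit_mul_plusPeriod_two) :
    Summit.BirchSwinnertonDyer.BirchSwinnertonDyer.Theses.ThetaPartnerAtTwo.MazurTateCongruenceAtTwoTop ↔
    ∀ (W : WeierstrassCurve ℚ) [W.IsElliptic] [W.IsGloballyMinimal] (A : WeierstrassCurve ℚ) [A.IsElliptic]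
      [A.IsGloballyMinimal], ¬ W.HasCM → W.analyticRank = 0 → GoodSS W 2 → W.frobeniusTrace 2 = 0 → A.HasCM → GoodSS A 2 →
      A.frobeniusTrace 2 = 0 →
      (∃ e : geomTorsion W (2 : ℤ) ≃+ geomTorsion A (2 : ℤ),
        ∀ (σ : Field.absoluteGaloisGroup ℚ) (P : geomTorsion W (2 : ℤ)), e (σ • P) = σ • e P) →
      ∀ [NeZero (W.conductorNorm ℤ)] (f : CuspForm (Gamma0 (W.conductorNorm ℤ)) 2), IsNewformOf W f →
      ∀ (Lplus Lminus : IwasawaAlgebra 2), IsPollackPair f 2 Lplus Lminus →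
      ∀ [NeZero (A.conductorNorm ℤ)] (fA : CuspForm (Gamma0 (A.conductorNorm ℤ)) 2), IsNewformOf A fA →
      ∀ (LplusA LminusA : IwasawaAlgebra 2), IsPollackPair fA 2 LplusA LminusA →
      ((∃ n : ℕ, IsUnit (PowerSeries.coeff n (kobayashiL 1 Lplus Lminus))) ↔
        (∃ n : ℕ, IsUnit (PowerSeries.coeff n (kobayashiL 1 LplusA LminusA)))) :=
  ⟨flatIff_of_mazurTateCongruenceAtTwoTop h2, mazurTateCongruenceAtTwoTop_of_fourFacts_muInvariance hES hSD hBz hSe h2⟩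

/-- **«`μ = 0` for both» ⟹ (μ-INV₂)**: the FLAT hypothesis of `mazurTateCongruenceAtTwoTop_of_fourFacts_flat` implies `μ`-invariance on
the theta habitat (both sides true), so (μ-INV₂) is at most as strong as the line's «`μ = 0` at `2`» inputs. [cite: Pollack2003, Conj. 6.3] -/
theorem muInvariance_of_flat
    (hFlat : ∀ (E : WeierstrassCurve ℚ) [E.IsElliptic] [E.IsGloballyMinimal], GoodSS E 2 → E.frobeniusTrace 2 = 0 →
      ∀ [NeZero (E.conductorNorm ℤ)] (f : CuspForm (Gamma0 (E.conductorNorm ℤ)) 2), IsNewformOf E f →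
      ∀ (Lplus Lminus : IwasawaAlgebra 2), IsPollackPair f 2 Lplus Lminus →
      ∃ n : ℕ, IsUnit (PowerSeries.coeff n (kobayashiL 1 Lplus Lminus))) :
    ∀ (W : WeierstrassCurve ℚ) [W.IsElliptic] [W.IsGloballyMinimal] (A : WeierstrassCurve ℚ) [A.IsElliptic]
      [A.IsGloballyMinimal], ¬ W.HasCM → W.analyticRank = 0 → GoodSS W 2 → W.frobeniusTrace 2 = 0 → A.HasCM → GoodSS A 2 →
      A.frobeniusTrace 2 = 0 →
      (∃ e : geomTorsion W (2 : ℤ) ≃+ geomTorsion A (2 : ℤ),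
        ∀ (σ : Field.absoluteGaloisGroup ℚ) (P : geomTorsion W (2 : ℤ)), e (σ • P) = σ • e P) →
      ∀ [NeZero (W.conductorNorm ℤ)] (f : CuspForm (Gamma0 (W.conductorNorm ℤ)) 2), IsNewformOf W f →
      ∀ (Lplus Lminus : IwasawaAlgebra 2), IsPollackPair f 2 Lplus Lminus →
      ∀ [NeZero (A.conductorNorm ℤ)] (fA : CuspForm (Gamma0 (A.conductorNorm ℤ)) 2), IsNewformOf A fA →
      ∀ (LplusA LminusA : IwasawaAlgebra 2), IsPollackPair fA 2 LplusA LminusA →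
      ((∃ n : ℕ, IsUnit (PowerSeries.coeff n (kobayashiL 1 Lplus Lminus))) ↔
        (∃ n : ℕ, IsUnit (PowerSeries.coeff n (kobayashiL 1 LplusA LminusA)))) := by
  intro W _ _ A _ _ _ _ hss ha _ hAss hAa _ _ f hf Lplus Lminus hPP _ fA hfA LplusA LminusA hPPA
  exact ⟨fun _ ↦ hFlat A hAss hAa fA hfA LplusA LminusA hPPA, fun _ ↦ hFlat W hss ha f hf Lplus Lminus hPP⟩

end Converse

end Summit.BirchSwinnertonDyer.BirchSwinnertonDyer.Theorems.MazurTateCongruenceAtTwoR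

end
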